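import Mathlib
import Summits.NavierStokesRegularity.NavierStokesRegularity.Theorems.EulerZoomLiouvillePowerGaugeEulerLiouvilleCondenserWeightedQuietSlice
import Summits.NavierStokesRegularity.NavierStokesRegularity.Theorems.EulerZoomLiouvillePowerGaugeEulerLiouvilleCondenserComplexChart
import Summits.NavierStokesRegularity.NavierStokesRegularity.Theorems.EulerZoomLiouvillePowerGaugeEulerLiouvilleCondenserFilamentCapacity
import Summits.NavierStokesRegularity.NavierStokesRegularity.Theorems.EulerZoomLiouvillePowerGaugeEulerLiouvilleCondenserCircleMeanCore
import Summits.NavierStokesRegularity.NavierStokesRegularity.Theorems.EulerZoomLiouvillePowerGaugeEulerLiouvilleNeedleDiscChart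

/-!
# SPECKS ON THE QUIET SLICE — coordinate frame (plate t47-F′₀, nsreg-p2 g35 ROUND-45, `r45/Sketch45b.lean`)

Width piece for crux `EulerZoomLiouville.PowerGaugeEulerLiouville` (stmt-NavierStokesRegularity-19832), by name under
LEAD 19832 (ns-typeII-p2 g13); seat ns-ezl-w2 g4, `--supports stmt-NavierStokesRegularity-19832 --as helper`.

The slice COROLLARY of LEMMA F (radius form `Condenser.radius_le_of_ballEnergy_lt`, ns-sfl-p1 g6) on the ROUND-45
`s²`-weighted quiet slice ((Q) `Condenser.weightedQuietSlice_of`), in the coordinate frame (height direction `e₂`, chart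
`NeedleDiscChart.discChart (plane s a₀) e₀ e₁`, `eᵢ = EuclideanSpace.basisFun (Fin 3) ℝ i`), with the ROUND-45 constant
`κ_F(Λ,θ) = πθ²γ²(Λ³−1)/(6(Λ+1)^{1−ρ}C_E)`:

* `speck_of_sliceBudgets` — ONE BASE POINT: for `V ∈ C¹(ℝ³,ℝ³)`, a base point `plane s a₀` with `‖plane s a₀‖ + R/2 < R'`,
  truncated slice budgets `𝒜` (of `‖V‖²`) and `ℰ` (of `‖DV‖²`) at height `s`, a level `A₀ > 0` with
  `√(2𝒜/π)/(R/2) < A₀/2` and `ℰ < A₀²/(2π)`: every connected `K ∋ 0` of radius `d ≤ R/(4e)` reaching every radius `< d`,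
  on whose chart image `−V₂ ≥ A₀`, has `d ≤ e·(R/2)·exp(−2π(A₀/2 − √(2𝒜/π)/(R/2))²/ℰ)`
  [scalar `φ = ⟪V∘Φ, −e₂⟫` through the `ℂ`-chart (t47-X disc budgets `setIntegral_cdisc_sq_inner_le` /
  `setIntegral_cdisc_sq_norm_fderiv_inner_le`), Chebyshev radius `r₁ ∈ [R/4,R/2]` (t47-C
  `exists_circleAverage_le_of_sq_budget`), LEMMA F `radius_le_of_ballEnergy_lt` with `A = A₀`, `r = r₁`];
* `sliceAmplitude_div_eq`, `sliceEnergyCoeff_eq` — the (Q) slice budgets as multiples of `R^{−(2+ρ)}`;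
* `exists_speckThreshold` — the constants: `η ∈ (0,1)` and `R₁` such that for `R ≥ R₁` the Chebyshev mean is `< θγR/2`,
  the slice energy coefficient is `< θ²γ²/(2π)`, and the exponent beats `1 + κ'R^{2+ρ}`;
* **`specksOnQuietSliceCoord`** = `NsregP2.R45.SpecksOnQuietSliceCoord` binder for binder (`E3'` spelled out).

HONEST FRAMING: real analysis in `ℝ³`/`ℂ` (no orbit, no exit: a pure budget statement); nothing here proves the crux E
(19832 OPEN), any door Target, or any Navier–Stokes statement; no summit statement is touched. [folklore (length–area
method, Chebyshev); cite: ConstantinIgnatovaVicol2026Putative, §3.4.1 for the setting]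
-/

noncomputable section

open Set Filter Topology Metric Function MeasureTheory Real
open scoped RealInnerProductSpace

set_option linter.dupNamespace false

namespace Summit.NavierStokesRegularity.NavierStokesRegularity.Theorems.PowerGaugeEulerLiouville.Condenser

/-! ## §1 One base point: a speck from the slice budgets -/

/-- **ONE BASE POINT.**  `V ∈ C¹(ℝ³,ℝ³)`, base point `plane s a₀` with `‖plane s a₀‖ + R/2 < R'`, truncated slice budgets
`∫ 𝟙_{B(0,R')}‖V‖²∘(plane s ·) ≤ 𝒜`, `∫ 𝟙_{B(0,R')}‖DV‖²∘(plane s ·) ≤ ℰ`, a level `A₀ > 0` with `√(2𝒜/π)/(R/2) < A₀/2` and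
`ℰ < A₀²/(2π)`.  Then every connected `K ∋ 0` with `K ⊆ B̄(0,d)`, `0 < d ≤ R/(4e)`, reaching every radius `< d`, on whose chart
image `−(V (discChart (plane s a₀) e₀ e₁ z)) 2 ≥ A₀`, satisfies `d ≤ e·(R/2)·exp(−2π(A₀/2 − √(2𝒜/π)/(R/2))²/ℰ)`. [folklore] -/
theorem speck_of_sliceBudgets {V : EuclideanSpace ℝ (Fin 3) → EuclideanSpace ℝ (Fin 3)} (hV : ContDiff ℝ 1 V)
    {s : ℝ} {a₀ : EuclideanSpace ℝ (Fin 2)} {R R' 𝒜 ℰ A₀ : ℝ} (hR : 0 < R) (hfit : ‖plane s a₀‖ + R / 2 < R')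
    (hA₀ : 0 < A₀)
    (h𝒜 : ∫ a, (ball (0 : EuclideanSpace ℝ (Fin 3)) R').indicator (fun x => ‖V x‖ ^ 2) (plane s a) ≤ 𝒜)
    (hℰ : ∫ a, (ball (0 : EuclideanSpace ℝ (Fin 3)) R').indicator (fun x => ‖fderiv ℝ V x‖ ^ 2) (plane s a) ≤ ℰ)
    (hB : Real.sqrt (2 * 𝒜 / π) / (R / 2) < A₀ / 2) (hℰA : ℰ < A₀ ^ 2 / (2 * π))
    {K : Set ℂ} {d : ℝ} (hK : IsConnected K) (h0K : (0 : ℂ) ∈ K) (hd : 0 < d) (hdR : d ≤ R / (4 * Real.exp 1))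
    (hKd : K ⊆ closedBall (0 : ℂ) d) (hreach : ∀ δ : ℝ, δ < d → ∃ z ∈ K, δ < ‖z‖)
    (hfast : ∀ z ∈ K, A₀ ≤ -(V (NeedleDiscChart.discChart (plane s a₀) (EuclideanSpace.basisFun (Fin 3) ℝ 0)
      (EuclideanSpace.basisFun (Fin 3) ℝ 1) z)) 2) :
    d ≤ Real.exp 1 * (R / 2) * Real.exp (-(2 * π * (A₀ / 2 - Real.sqrt (2 * 𝒜 / π) / (R / 2)) ^ 2 / ℰ)) := by
  have hπ : 0 < π := Real.pi_pos
  -- the scalar `φ = ⟪V ∘ Φ, -e₂⟫ = -(V ∘ Φ) 2` through the `ℂ`-chart at `y = plane s a₀`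
  set y : EuclideanSpace ℝ (Fin 3) := plane s a₀ with hy
  have hy2 : y 2 = s := plane_apply_two s a₀
  set u : EuclideanSpace ℝ (Fin 3) := -EuclideanSpace.basisFun (Fin 3) ℝ 2 with hu
  have hu1 : ‖u‖ ≤ 1 := by
    rw [hu, norm_neg, (EuclideanSpace.basisFun (Fin 3) ℝ).orthonormal.1 2]
  set φ : ℂ → ℝ := fun z =>
    ⟪V (y + z.re • EuclideanSpace.basisFun (Fin 3) ℝ 0 + z.im • EuclideanSpace.basisFun (Fin 3) ℝ 1), u⟫ with hφ
  have hφc : ContDiff ℝ 1 φ := contDiff_comp_cchart (f := fun x => ⟪V x, u⟫) (hV.inner ℝ contDiff_const) y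
  have hφ_eq : ∀ z, φ z = -(V (NeedleDiscChart.discChart y (EuclideanSpace.basisFun (Fin 3) ℝ 0)
      (EuclideanSpace.basisFun (Fin 3) ℝ 1) z)) 2 := by
    intro z
    simp only [hφ, hu, inner_neg_right, EuclideanSpace.inner_basisFun_real, NeedleDiscChart.discChart]
  have hφK : ∀ z ∈ K, A₀ ≤ φ z := fun z hz => by rw [hφ_eq]; exact hfast z hz
  have hφ0 : 0 < φ 0 := hA₀.trans_le (hφK 0 h0K)
  -- disc budgets (t47-X)
  have hR2 : 0 < R / 2 := by positivity
  have hAdisc : ∫ z in closedBall (0 : ℂ) (R / 2), φ z ^ 2 ≤ 𝒜 := by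
    have h := setIntegral_cdisc_sq_inner_le hV hu1 hfit
    rw [hy2] at h
    exact h.trans h𝒜
  have hEdisc : ∫ z in closedBall (0 : ℂ) (R / 2), ‖fderiv ℝ φ z‖ ^ 2 ≤ ℰ := by
    have h := setIntegral_cdisc_sq_norm_fderiv_inner_le hV hu1 hfit
    rw [hy2] at h
    exact h.trans hℰ
  -- the Chebyshev radius (t47-C)
  obtain ⟨r₁, hr₁, hmean⟩ := exists_circleAverage_le_of_sq_budget hφc.continuous hR2 hφ0 hAdisc
  set B : ℝ := Real.sqrt (2 * 𝒜 / π) / (R / 2) with hBdef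
  have hr₁R : r₁ ≤ R / 2 := hr₁.2
  have hr₁4 : R / 4 ≤ r₁ := by have := hr₁.1; linarith
  have hr₁0 : 0 < r₁ := by linarith
  -- the ball energy at the Chebyshev radius
  set Eb : ℝ := ∫ z in ball (0 : ℂ) r₁, ‖fderiv ℝ φ z‖ ^ 2 with hEb
  have hEb_le : Eb ≤ ℰ := by
    refine le_trans ?_ hEdisc
    refine setIntegral_mono_set ?_ ?_ ?_
    · exact (((hφc.continuous_fderiv one_ne_zero).norm).pow 2).continuousOn.integrableOn_compact
        (isCompact_closedBall _ _)
    · exact Eventually.of_forall fun z => sq_nonneg _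
    · exact Eventually.of_forall (ball_subset_closedBall.trans (closedBall_subset_closedBall hr₁R))
  have hEbA : Eb < A₀ ^ 2 / (2 * π) := hEb_le.trans_lt hℰA
  -- the hypotheses of LEMMA F at the origin with `A = A₀`, `r = r₁`
  have he1 : 1 < Real.exp 1 := by
    have := Real.add_one_lt_exp (one_ne_zero (α := ℝ))
    linarith
  have he0 : 0 < Real.exp 1 := Real.exp_pos 1
  have hdr : d ≤ r₁ / Real.exp 1 := by
    calc d ≤ R / (4 * Real.exp 1) := hdR
      _ = R / 4 / Real.exp 1 := by rw [div_div]
      _ ≤ r₁ / Real.exp 1 := div_le_div_of_nonneg_right hr₁4 he0.le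
  have hreach' : ∀ δ : ℝ, δ < d → ∃ z ∈ K, δ < dist z 0 := fun δ hδ => by
    simpa only [dist_zero_right] using hreach δ hδ
  have hrad := radius_le_of_ballEnergy_lt φ hφc K 0 A₀ B d r₁ hK h0K hφK hA₀ hB hd hdr hKd hreach' hmean hEbA
  -- `Eb > 0`, from LEMMA F itself
  have hEb0 : 0 < Eb := by
    have hF := filamentCapacity φ hφc K 0 A₀ B d r₁ hK h0K hφK hA₀ hB hd hdr hKd hreach' hmean
    refine lt_of_lt_of_le (lt_min (by positivity) ?_) hF
    have h1 : 0 < (A₀ / 2 - B) ^ 2 := by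
      have : 0 < A₀ / 2 - B := by linarith
      positivity
    have h2 : 0 < Real.log (Real.exp 1 * r₁ / d) := by
      apply Real.log_pos
      rw [lt_div_iff₀ hd, one_mul]
      calc d ≤ r₁ / Real.exp 1 := hdr
        _ < r₁ := div_lt_self hr₁0 he1
        _ < Real.exp 1 * r₁ := lt_mul_left hr₁0 he1
    positivity
  -- monotonicity in the energy and in the radius
  have hexp : Real.exp (-(2 * π * (A₀ / 2 - B) ^ 2 / Eb)) ≤ Real.exp (-(2 * π * (A₀ / 2 - B) ^ 2 / ℰ)) := by
    apply Real.exp_le_exp.2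
    apply neg_le_neg
    exact div_le_div_of_nonneg_left (by positivity) hEb0 hEb_le
  have hpos : 0 ≤ Real.exp (-(2 * π * (A₀ / 2 - B) ^ 2 / Eb)) := (Real.exp_pos _).le
  calc d ≤ Real.exp 1 * r₁ * Real.exp (-(2 * π * (A₀ / 2 - B) ^ 2 / Eb)) := hrad
    _ ≤ Real.exp 1 * (R / 2) * Real.exp (-(2 * π * (A₀ / 2 - B) ^ 2 / ℰ)) :=
        mul_le_mul (mul_le_mul_of_nonneg_left hr₁R he0.le) hexp hpos (by positivity)

/-! ## §2 The constants -/

/-- **The Chebyshev mean over `R`, as a power.**  For `0 ≤ Λ + 1`, `0 < R`: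
`√(2(C_A((Λ+1)R)^{1−2ρ}/(η(Λ−1)R))/π)/(R/2)/R = 2√(2(C_A(Λ+1)^{1−2ρ}/(η(Λ−1)))/π)·R^{−(2+ρ)}`. [folklore] -/
theorem sliceAmplitude_div_eq {C_A Λ η ρ R : ℝ} (hΛ : 0 ≤ Λ + 1) (hR : 0 < R) :
    Real.sqrt (2 * (C_A * ((Λ + 1) * R) ^ (1 - 2 * ρ) / (η * (Λ - 1) * R)) / π) / (R / 2) / R =
      2 * Real.sqrt (2 * (C_A * (Λ + 1) ^ (1 - 2 * ρ) / (η * (Λ - 1))) / π) * R ^ (-(2 + ρ)) := by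
  have hRρ : 0 ≤ R ^ (-ρ) := Real.rpow_nonneg hR.le _
  have h12 : R ^ (1 - 2 * ρ) = (R ^ (-ρ)) ^ 2 * R := by
    rw [show (1 - 2 * ρ : ℝ) = -ρ * 2 + 1 by ring, Real.rpow_add_one hR.ne', Real.rpow_mul hR.le, Real.rpow_two]
  have hin : 2 * (C_A * ((Λ + 1) * R) ^ (1 - 2 * ρ) / (η * (Λ - 1) * R)) / π =
      2 * (C_A * (Λ + 1) ^ (1 - 2 * ρ) / (η * (Λ - 1))) / π * (R ^ (-ρ)) ^ 2 := by
    rw [Real.mul_rpow hΛ hR.le, h12]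
    field_simp
  have hsq : Real.sqrt (2 * (C_A * ((Λ + 1) * R) ^ (1 - 2 * ρ) / (η * (Λ - 1) * R)) / π) =
      Real.sqrt (2 * (C_A * (Λ + 1) ^ (1 - 2 * ρ) / (η * (Λ - 1))) / π) * R ^ (-ρ) := by
    rw [hin, Real.sqrt_mul' _ (sq_nonneg _), Real.sqrt_sq hRρ]
  have hneg : R ^ (-(2 + ρ)) = R ^ (-ρ) / R ^ 2 := by
    rw [show (-(2 + ρ) : ℝ) = -ρ - 2 by ring, Real.rpow_sub hR, Real.rpow_two]
  rw [hsq, hneg]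
  field_simp

/-- **The slice energy coefficient, as a power.**  For `0 ≤ Λ + 1`, `0 < R`:
`3(C_E((Λ+1)R)^{1−ρ})/((μ³−1)R³) = 3(C_E(Λ+1)^{1−ρ})/(μ³−1)·R^{−(2+ρ)}` (`μ = 1 + (1−η)(Λ−1)`). [folklore] -/
theorem sliceEnergyCoeff_eq {C_E Λ η ρ R : ℝ} (hΛ : 0 ≤ Λ + 1) (hR : 0 < R) :
    3 * (C_E * ((Λ + 1) * R) ^ (1 - ρ)) / (((1 + (1 - η) * (Λ - 1)) ^ 3 - 1) * R ^ 3) =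
      3 * (C_E * (Λ + 1) ^ (1 - ρ)) / ((1 + (1 - η) * (Λ - 1)) ^ 3 - 1) * R ^ (-(2 + ρ)) := by
  have hneg : R ^ (-(2 + ρ)) = R ^ (1 - ρ) / R ^ 3 := by
    rw [show (-(2 + ρ) : ℝ) = (1 - ρ) - 3 by ring, Real.rpow_sub hR]
    congr 1
    exact_mod_cast Real.rpow_natCast R 3
  have hR3 : 0 < R ^ 3 := by positivity
  rw [Real.mul_rpow hΛ hR.le, hneg]
  field_simp

/-- **THE CONSTANTS.**  For `0 < γ`, `0 ≤ ρ`, `0 < C_A`, `0 < C_E`, `1 < Λ`, `0 < θ` and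
`κ' < κ_F(Λ,θ) = πθ²γ²(Λ³−1)/(6(Λ+1)^{1−ρ}C_E)` there are `η ∈ (0,1)` and `R₁ > 0` such that for every `R ≥ R₁`
(with the (Q) budgets `𝒜(R) = C_A((Λ+1)R)^{1−2ρ}/(η(Λ−1)R)`, `ℰ(R) = 3C_E((Λ+1)R)^{1−ρ}/(((1+(1−η)(Λ−1))³−1)R³)`):
`√(2𝒜(R)/π)/(R/2)/R < θγ/2`, `ℰ(R) < θ²γ²/(2π)`, and `1 + κ'R^{2+ρ} ≤ 2π(θγ/2 − √(2𝒜(R)/π)/(R/2)/R)²/ℰ(R)`.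
(Continuity of `η ↦ πθ²γ²((1+(1−η)(Λ−1))³−1)/(6(Λ+1)^{1−ρ}C_E)` at `η = 0`, then `R^{−(2+ρ)} → 0`.) [folklore] -/
theorem exists_speckThreshold {γ ρ C_A C_E Λ θ κ' : ℝ} (hγ : 0 < γ) (hρ : 0 ≤ ρ) (hCA : 0 < C_A) (hCE : 0 < C_E)
    (hΛ : 1 < Λ) (hθ : 0 < θ) (hκ' : κ' < π * θ ^ 2 * γ ^ 2 * (Λ ^ 3 - 1) / (6 * (Λ + 1) ^ (1 - ρ) * C_E)) :
    ∃ η : ℝ, 0 < η ∧ η < 1 ∧ ∃ R₁ : ℝ, 0 < R₁ ∧ ∀ R : ℝ, R₁ ≤ R →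
      Real.sqrt (2 * (C_A * ((Λ + 1) * R) ^ (1 - 2 * ρ) / (η * (Λ - 1) * R)) / π) / (R / 2) / R < θ * γ / 2 ∧
      3 * (C_E * ((Λ + 1) * R) ^ (1 - ρ)) / (((1 + (1 - η) * (Λ - 1)) ^ 3 - 1) * R ^ 3) < θ ^ 2 * γ ^ 2 / (2 * π) ∧
      1 + κ' * R ^ (2 + ρ) ≤
        2 * π * (θ * γ / 2 -
            Real.sqrt (2 * (C_A * ((Λ + 1) * R) ^ (1 - 2 * ρ) / (η * (Λ - 1) * R)) / π) / (R / 2) / R) ^ 2 /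
          (3 * (C_E * ((Λ + 1) * R) ^ (1 - ρ)) / (((1 + (1 - η) * (Λ - 1)) ^ 3 - 1) * R ^ 3)) := by
  have hπ : 0 < π := Real.pi_pos
  have hΛ1 : 0 < Λ + 1 := by linarith
  have hΛρ : 0 < (Λ + 1) ^ (1 - ρ) := Real.rpow_pos_of_pos hΛ1 _
  -- Step A: the choice of `η`
  set f : ℝ → ℝ := fun η => π * θ ^ 2 * γ ^ 2 * ((1 + (1 - η) * (Λ - 1)) ^ 3 - 1) / (6 * (Λ + 1) ^ (1 - ρ) * C_E)
    with hf
  have hfc : Continuous f := by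
    rw [hf]
    fun_prop
  have hf0 : κ' < f 0 := by
    have h : f 0 = π * θ ^ 2 * γ ^ 2 * (Λ ^ 3 - 1) / (6 * (Λ + 1) ^ (1 - ρ) * C_E) := by
      simp only [hf]
      ring
    rw [h]
    exact hκ'
  have hev : ∀ᶠ η in 𝓝 (0 : ℝ), κ' < f η := (hfc.tendsto 0).eventually_const_lt hf0
  obtain ⟨η, hκη, hη0, hη1⟩ : ∃ η, κ' < f η ∧ 0 < η ∧ η < 1 := by
    have h : ∀ᶠ η in 𝓝[>] (0 : ℝ), κ' < f η ∧ 0 < η ∧ η < 1 := by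
      filter_upwards [hev.filter_mono nhdsWithin_le_nhds, Ioo_mem_nhdsGT (zero_lt_one' ℝ)] with η h1 h2
      exact ⟨h1, h2.1, h2.2⟩
    exact h.exists
  refine ⟨η, hη0, hη1, ?_⟩
  -- the constants at this `η`
  have hμ1 : 1 < 1 + (1 - η) * (Λ - 1) := by nlinarith
  have hμ3 : 0 < (1 + (1 - η) * (Λ - 1)) ^ 3 - 1 := sub_pos.2 (one_lt_pow₀ hμ1 (by norm_num))
  set cB : ℝ := 2 * Real.sqrt (2 * (C_A * (Λ + 1) ^ (1 - 2 * ρ) / (η * (Λ - 1))) / π) with hcB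
  set cE : ℝ := 3 * (C_E * (Λ + 1) ^ (1 - ρ)) / ((1 + (1 - η) * (Λ - 1)) ^ 3 - 1) with hcE
  have hcB0 : 0 ≤ cB := by positivity
  have hcE0 : 0 < cE := div_pos (by positivity) hμ3
  have hfη : f η = 2 * π * (θ * γ / 2) ^ 2 / cE := by
    simp only [hf, hcE]
    field_simp
    ring
  have hL : 0 < f η - κ' := sub_pos.2 hκη
  -- Step B: the limits `R^{-(2+ρ)} → 0`, `R^{2+ρ} → ∞`
  have hp : 0 < 2 + ρ := by linarith
  have hlim0 : Tendsto (fun R : ℝ => R ^ (-(2 + ρ))) atTop (𝓝 0) := tendsto_rpow_neg_atTop hp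
  have hE2 : ∀ᶠ R in atTop, cB * R ^ (-(2 + ρ)) < θ * γ / 2 := by
    have h := hlim0.const_mul cB
    rw [mul_zero] at h
    exact h.eventually_lt_const (by positivity)
  have hE3 : ∀ᶠ R in atTop, cE * R ^ (-(2 + ρ)) < θ ^ 2 * γ ^ 2 / (2 * π) := by
    have h := hlim0.const_mul cE
    rw [mul_zero] at h
    exact h.eventually_lt_const (by positivity)
  have hg : Tendsto (fun R : ℝ => 2 * π * (θ * γ / 2 - cB * R ^ (-(2 + ρ))) ^ 2 / cE - κ') atTop
      (𝓝 (f η - κ')) := by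
    have h := ((tendsto_const_nhds (x := θ * γ / 2)).sub (hlim0.const_mul cB)).pow 2
      |>.const_mul (2 * π) |>.div_const cE |>.sub_const κ'
    rw [mul_zero, sub_zero, ← hfη] at h
    exact h
  have hE4a : ∀ᶠ R in atTop, (f η - κ') / 2 ≤ 2 * π * (θ * γ / 2 - cB * R ^ (-(2 + ρ))) ^ 2 / cE - κ' :=
    hg.eventually_const_le (by linarith)
  have hE4b : ∀ᶠ R in atTop, 2 / (f η - κ') ≤ R ^ (2 + ρ) := (tendsto_rpow_atTop hp).eventually_ge_atTop _
  obtain ⟨R₀, hR₀⟩ := Filter.eventually_atTop.1 (hE2.and (hE3.and (hE4a.and hE4b)))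
  refine ⟨max R₀ 1, lt_max_of_lt_right one_pos, fun R hR => ?_⟩
  have hR0 : 0 < R := lt_of_lt_of_le (lt_max_of_lt_right one_pos) hR
  obtain ⟨h2, h3, h4a, h4b⟩ := hR₀ R ((le_max_left _ _).trans hR)
  -- Step C: back to the raw expressions
  rw [sliceAmplitude_div_eq hΛ1.le hR0, sliceEnergyCoeff_eq hΛ1.le hR0, ← hcB, ← hcE]
  refine ⟨h2, h3, ?_⟩
  have hRp : 0 < R ^ (2 + ρ) := Real.rpow_pos_of_pos hR0 _
  have hRn : R ^ (-(2 + ρ)) = (R ^ (2 + ρ))⁻¹ := Real.rpow_neg hR0.le _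
  rw [hRn] at h4a ⊢
  set Q : ℝ := 2 * π * (θ * γ / 2 - cB * (R ^ (2 + ρ))⁻¹) ^ 2 / cE with hQ
  have hprod : 1 ≤ (Q - κ') * R ^ (2 + ρ) := by
    calc (1 : ℝ) = (f η - κ') / 2 * (2 / (f η - κ')) := by field_simp
      _ ≤ (Q - κ') * R ^ (2 + ρ) := mul_le_mul h4a h4b (by positivity) (by linarith)
  have hQP : 2 * π * (θ * γ / 2 - cB * (R ^ (2 + ρ))⁻¹) ^ 2 / (cE * (R ^ (2 + ρ))⁻¹) = Q * R ^ (2 + ρ) := by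
    rw [hQ]
    field_simp
  rw [hQP]
  have : (Q - κ') * R ^ (2 + ρ) = Q * R ^ (2 + ρ) - κ' * R ^ (2 + ρ) := by ring
  linarith

/-! ## §3 The slice corollary of LEMMA F, coordinate frame -/

set_option maxHeartbeats 400000 in
/-- **`NsregP2.R45.SpecksOnQuietSliceCoord`, binder for binder** (Sketch45b of nsreg-p2 g35, plate t47-F′₀; `E3'` spelled out,
`plane` = `Condenser.plane`).  SPECKS ON THE QUIET SLICE, coordinate frame: for `κ' < κ_F(Λ,θ)` and `R ≥ R₁`, under the
ball budgets on `B(0,(Λ+1)R)`, there is ONE height `s ∈ [R,ΛR]` (the (Q)-height) such that at every base point `plane s a₀`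
with `‖plane s a₀‖ ≤ ΛR`, every connected planar `K ∋ 0` of radius `d ≤ R/(4e)` reaching every radius `< d`, on whose chart
image `−V₂ ≥ θγs`, has `d ≤ R·exp(−κ'R^{2+ρ})` — specks, not filaments.  [(Q) `weightedQuietSlice_of` with `F = ‖V‖²`,
`G = ‖DV‖²`, `R' = (Λ+1)R`; `speck_of_sliceBudgets` at each base point; `exists_speckThreshold`.] [folklore] -/
theorem specksOnQuietSliceCoord :
    ∀ (γ ρ C_A C_E Λ θ κ' : ℝ), 0 < γ → 0 ≤ ρ → 0 < C_A → 0 < C_E → 1 < Λ → 0 < θ →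
      κ' < Real.pi * θ ^ 2 * γ ^ 2 * (Λ ^ 3 - 1) / (6 * (Λ + 1) ^ (1 - ρ) * C_E) →
      ∃ R₁ : ℝ, 0 < R₁ ∧
        ∀ (V : EuclideanSpace ℝ (Fin 3) → EuclideanSpace ℝ (Fin 3)), ContDiff ℝ 1 V →
          ∀ R : ℝ, R₁ ≤ R →
            (∫ x in ball (0 : EuclideanSpace ℝ (Fin 3)) ((Λ + 1) * R), ‖V x‖ ^ 2 ≤
              C_A * ((Λ + 1) * R) ^ (1 - 2 * ρ)) →
            (∫ x in ball (0 : EuclideanSpace ℝ (Fin 3)) ((Λ + 1) * R), ‖fderiv ℝ V x‖ ^ 2 ≤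
              C_E * ((Λ + 1) * R) ^ (1 - ρ)) →
              ∃ s ∈ Icc R (Λ * R),
                ∀ (a₀ : EuclideanSpace ℝ (Fin 2)), ‖Condenser.plane s a₀‖ ≤ Λ * R →
                  ∀ (K : Set ℂ) (d : ℝ), IsConnected K → (0 : ℂ) ∈ K → 0 < d → d ≤ R / (4 * Real.exp 1) →
                    K ⊆ closedBall (0 : ℂ) d → (∀ δ : ℝ, δ < d → ∃ z ∈ K, δ < ‖z‖) →
                    (∀ z ∈ K, θ * γ * s ≤
                      -(V (NeedleDiscChart.discChart (Condenser.plane s a₀) (EuclideanSpace.basisFun (Fin 3) ℝ 0)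
                        (EuclideanSpace.basisFun (Fin 3) ℝ 1) z)) 2) →
                    d ≤ R * Real.exp (-(κ' * R ^ (2 + ρ))) := by
  intro γ ρ C_A C_E Λ θ κ' hγ hρ hCA hCE hΛ hθ hκ'
  have hπ : 0 < π := Real.pi_pos
  obtain ⟨η, hη0, hη1, R₁, hR₁, hgood⟩ := exists_speckThreshold hγ hρ hCA hCE hΛ hθ hκ'
  refine ⟨R₁, hR₁, fun V hV R hR hXA hYE => ?_⟩
  have hR0 : 0 < R := hR₁.trans_le hR
  have hΛ1 : 0 < Λ + 1 := by linarith
  obtain ⟨hE2, hE3, hE4⟩ := hgood R hR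
  have hX : 0 < C_A * ((Λ + 1) * R) ^ (1 - 2 * ρ) := mul_pos hCA (Real.rpow_pos_of_pos (mul_pos hΛ1 hR0) _)
  have hY : 0 < C_E * ((Λ + 1) * R) ^ (1 - ρ) := mul_pos hCE (Real.rpow_pos_of_pos (mul_pos hΛ1 hR0) _)
  -- the weighted quiet slice (t47-Q)
  obtain ⟨s, hs, hAs, hEs⟩ := weightedQuietSlice_of (F := fun x => ‖V x‖ ^ 2) (G := fun x => ‖fderiv ℝ V x‖ ^ 2)
    (hV.continuous.norm.pow 2) ((hV.continuous_fderiv one_ne_zero).norm.pow 2) (fun _ => sq_nonneg _)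
    (fun _ => sq_nonneg _) hR0 hΛ hη0 hη1 hX hY hXA hYE
  refine ⟨s, hs, fun a₀ ha₀ K d hK h0K hd hdR hKd hreach hfast => ?_⟩
  have hsR : R ≤ s := hs.1
  have hs0 : 0 < s := hR0.trans_le hsR
  -- the constants at this scale
  have hμ1 : 1 < 1 + (1 - η) * (Λ - 1) := by nlinarith
  have hμ3 : 0 < (1 + (1 - η) * (Λ - 1)) ^ 3 - 1 := sub_pos.2 (one_lt_pow₀ hμ1 (by norm_num))
  set Bq : ℝ := Real.sqrt (2 * (C_A * ((Λ + 1) * R) ^ (1 - 2 * ρ) / (η * (Λ - 1) * R)) / π) / (R / 2) with hBq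
  set Ec : ℝ := 3 * (C_E * ((Λ + 1) * R) ^ (1 - ρ)) / (((1 + (1 - η) * (Λ - 1)) ^ 3 - 1) * R ^ 3) with hEc
  have hBq0 : 0 ≤ Bq := by positivity
  have hEc0 : 0 < Ec := div_pos (by positivity) (by positivity)
  have hA₀ : 0 < θ * γ * s := by positivity
  have hfit : ‖plane s a₀‖ + R / 2 < (Λ + 1) * R := by linarith
  have hBR : Bq < θ * γ / 2 * R := (div_lt_iff₀ hR0).1 hE2
  have hB : Bq < θ * γ * s / 2 := by
    calc Bq < θ * γ / 2 * R := hBR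
      _ ≤ θ * γ / 2 * s := mul_le_mul_of_nonneg_left hsR (by positivity)
      _ = θ * γ * s / 2 := by ring
  have hℰA : Ec * s ^ 2 < (θ * γ * s) ^ 2 / (2 * π) := by
    calc Ec * s ^ 2 < θ ^ 2 * γ ^ 2 / (2 * π) * s ^ 2 := mul_lt_mul_of_pos_right hE3 (pow_pos hs0 2)
      _ = (θ * γ * s) ^ 2 / (2 * π) := by ring
  -- one base point
  have hspeck := speck_of_sliceBudgets hV hR0 hfit hA₀ hAs hEs hB hℰA hK h0K hd hdR hKd hreach hfast
  -- the exponent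
  have hkey : 1 + κ' * R ^ (2 + ρ) ≤ 2 * π * (θ * γ * s / 2 - Bq) ^ 2 / (Ec * s ^ 2) := by
    refine hE4.trans ?_
    have h0 : 0 ≤ θ * γ / 2 - Bq / R := by
      have := (div_lt_iff₀ hR0).2 hBR
      linarith [div_le_div_of_nonneg_left hBq0 hR0 le_rfl]
    have hle : θ * γ / 2 - Bq / R ≤ θ * γ / 2 - Bq / s := by
      linarith [div_le_div_of_nonneg_left hBq0 hR0 hsR]
    have hsq : (θ * γ / 2 - Bq / R) ^ 2 ≤ (θ * γ / 2 - Bq / s) ^ 2 := pow_le_pow_left₀ h0 hle 2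
    have heq : 2 * π * (θ * γ * s / 2 - Bq) ^ 2 / (Ec * s ^ 2) = 2 * π * (θ * γ / 2 - Bq / s) ^ 2 / Ec := by
      field_simp
    rw [heq]
    exact div_le_div_of_nonneg_right (mul_le_mul_of_nonneg_left hsq (by positivity)) hEc0.le
  have he0 : 0 < Real.exp 1 := Real.exp_pos 1
  calc d ≤ Real.exp 1 * (R / 2) * Real.exp (-(2 * π * (θ * γ * s / 2 - Bq) ^ 2 / (Ec * s ^ 2))) := hspeck
    _ ≤ Real.exp 1 * (R / 2) * Real.exp (-(1 + κ' * R ^ (2 + ρ))) :=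
        mul_le_mul_of_nonneg_left (Real.exp_le_exp.2 (neg_le_neg hkey)) (by positivity)
    _ = R / 2 * Real.exp (-(κ' * R ^ (2 + ρ))) := by
        rw [neg_add, Real.exp_add, Real.exp_neg]
        field_simp
    _ ≤ R * Real.exp (-(κ' * R ^ (2 + ρ))) := by
        have := Real.exp_pos (-(κ' * R ^ (2 + ρ)))
        nlinarith

end Summit.NavierStokesRegularity.NavierStokesRegularity.Theorems.PowerGaugeEulerLiouville.Condenser

end
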